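import Summits.AtomisticToContinuum.BoseEinsteinCondensation.Theorems.BlockLatticeFSumEngineChar

/-!
# BlockLatticeFSum — kernel ENGINE: the lattice f-sum identity on the block torus `(ℤ/K)³`

Abstract, state-independent form of the identity that makes `ShellBudget` true (decomp-a2c lens-6
g22, node `BlockLatticeFSum`). For ANY "Gram function" `G B B'` (in the application
`G B B' = ⟨u_B, γ_Ψ u_{B'}⟩`, `u_B` the normalised block indicators) define the block-wave occupation
`nf G q = K⁻³ Σ_{B,B'} χ_q(B' − B) G B B'` (`= ⟨f_q, γ f_q⟩`, `χ_q(r) = ∏_j e^{2πi q_j r_j/K}`) and the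
double-block occupation `nD G B j = (G B B + G B⁺B⁺ + G B B⁺ + G B⁺ B)/2`, `B⁺ = B + e_j`
(`= ⟨u_{D(B,j)}, γ u_{D(B,j)}⟩`, `u_D = (u_B + u_{B⁺})/√2`). Then, with the lattice weights
`w_j(q) = 1 − (χ(q_j) + χ(−q_j))/2 = 1 − cos(2πq_j/K)` and `ε(q) = Σ_j w_j(q)`:

* `fsum_axis`  : `Σ_q w_j(q)·nf G q = Σ_B G B B − (Σ_B G B B⁺ + Σ_B G B⁺ B)/2`;
* `fsum_axis_doubleBlock` : `Σ_q w_j(q)·nf G q + Σ_B nD G B j = 2 Σ_B G B B`;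
* `fsum_total` : `Σ_q ε(q)·nf G q + Σ_j Σ_B nD G B j = 6 Σ_B G B B`;
* `fsum_total_bond` : `Σ_q ε(q)·nf G q = Σ_j Σ_B nA G B j` (antisymmetric bond modes);
* `superblock_cs`, `shellBudget_superblock`, `shellBudget_gram` : in the Gram representation
  `G B B' = ⟪w_B, w_B'⟫`, Cauchy–Schwarz inside each 2×2×2 super-block and the count over all corners
  turn super-block condensation `Σ_c ‖Σ_τ w_{c+τ}‖²/8 ≥ 8(1−η)N` into `Re Σ_q ε(q) nf q ≤ 6ηN` —
  the route's `ShellBudget` with 13595 (at block constant 2A) as the only input.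

All sorry-free over Mathlib (`ZMod.stdAddChar`, `AddChar.sum_mulShift`, `ZMod.isPrimitive_stdAddChar`).
The only input is character orthogonality `Σ_q χ_q(r) = K³·[r = 0]` (`sum_chi`).
-/

namespace Summit.AtomisticToContinuum.BoseEinsteinCondensation.Theses.BlockLatticeFSum.Engine

open scoped BigOperators

noncomputable section

variable {K : ℕ} [NeZero K]

/-! ### Super-block form (the route's `ShellBudget`): bond modes, Gram representation,
Cauchy–Schwarz inside a 2×2×2 super-block, all translates of the super-block

`nA G B j = ⟨a_{B,j}, γ a_{B,j}⟩` for the antisymmetric bond mode `a = (u_B − u_{B+e_j})/√2`;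
`fsum_total_bond : Σ_q ε(q)·nf G q = Σ_j Σ_B nA G B j`. In the GRAM REPRESENTATION
`G B B' = ⟪w_B, w_{B'}⟫` (the occupation form is positive: `⟨g, γ g⟩ = ‖Σ_B c_B w_B‖²` for
`g = Σ_B c_B u_B`; in the application `w_B(X') = √N ∫ conj(u_B)(x) Ψ(x, X') dx`) one has
`nA = ‖w_B − w_{B+e_j}‖²/2`, and for the super-block with corner `c` (blocks `c + τ`, `τ ∈ {0,1}³`):
`Σ_{τ_j = 0} ‖w_{c+τ} − w_{c+τ+e_j}‖²/2 ≤ Σ_τ ‖w_{c+τ}‖² − ‖Σ_τ w_{c+τ}‖²/8` (`superblock_cs`: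
parallelogram law + Cauchy–Schwarz, `u_S = ½ Σ_pairs d`). Summing over ALL corners `c` (every bond is
an interior j-bond of exactly 4 corners; the 8 half-shifted tilings together are all corners) gives
`shellBudget_superblock`: `‖w_B‖² ≤ N_B`, `Σ N_B = N`, `Σ_c ‖Σ_τ w_{c+τ}‖²/8 ≥ 8(1−η)N`
⟹ `Σ_j Σ_B ‖w_B − w_{B+e_j}‖²/2 ≤ 6ηN`, i.e. `Re Σ_q ε(q) nf q ≤ 6ηN` (`shellBudget_gram`). -/

/-- Antisymmetric BOND-mode occupation `⟨a_{B,j}, γ a_{B,j}⟩`, `a_{B,j} = (u_B − u_{B+e_j})/√2`. -/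
def nA (G : (Fin 3 → ZMod K) → (Fin 3 → ZMod K) → ℂ) (B : Fin 3 → ZMod K) (j : Fin 3) : ℂ :=
  (G B B + G (B + e j) (B + e j) - G B (B + e j) - G (B + e j) B) / 2

omit [NeZero K] in
/-- Antisymmetric plus symmetric bond-mode occupations recombine to the two diagonal block occupations. -/
theorem nA_add_nD (G : (Fin 3 → ZMod K) → (Fin 3 → ZMod K) → ℂ) (B : Fin 3 → ZMod K) (j : Fin 3) :
    nA G B j + nD G B j = G B B + G (B + e j) (B + e j) := by
  unfold nA nD; ring

/-- **Lattice f-sum identity, bond form, one axis:** `Σ_q w_j(q)⟨f_q,γf_q⟩ = Σ_B ⟨a_{B,j},γa_{B,j}⟩`. -/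
theorem fsum_axis_bond (G : (Fin 3 → ZMod K) → (Fin 3 → ZMod K) → ℂ) (j : Fin 3) :
    ∑ q : Fin 3 → ZMod K, w j q * nf G q = ∑ B : Fin 3 → ZMod K, nA G B j := by
  classical
  have h := fsum_axis_doubleBlock G j
  have hshift : ∑ B : Fin 3 → ZMod K, G (B + e j) (B + e j) = ∑ B : Fin 3 → ZMod K, G B B := by
    refine Fintype.sum_equiv (Equiv.addRight (e j)) _ _ fun B => ?_
    simp [Equiv.addRight]
  have hsplit : ∑ B : Fin 3 → ZMod K, nA G B j
      = (∑ B : Fin 3 → ZMod K, G B B + ∑ B : Fin 3 → ZMod K, G (B + e j) (B + e j))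
        - ∑ B : Fin 3 → ZMod K, nD G B j := by
    rw [← Finset.sum_add_distrib, ← Finset.sum_sub_distrib]
    refine Finset.sum_congr rfl fun B _ => ?_
    rw [← nA_add_nD]; ring
  rw [hsplit, hshift]
  linear_combination h

/-- **Lattice f-sum identity, bond form (total):** `Σ_q ε(q)⟨f_q,γf_q⟩ = Σ_j Σ_B ⟨a_{B,j},γa_{B,j}⟩`. -/
theorem fsum_total_bond (G : (Fin 3 → ZMod K) → (Fin 3 → ZMod K) → ℂ) :
    ∑ q : Fin 3 → ZMod K, eps q * nf G q = ∑ j : Fin 3, ∑ B : Fin 3 → ZMod K, nA G B j := by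
  classical
  have : ∑ q : Fin 3 → ZMod K, eps q * nf G q
      = ∑ j : Fin 3, ∑ q : Fin 3 → ZMod K, w j q * nf G q := by
    unfold eps
    simp_rw [Finset.sum_mul]
    rw [Finset.sum_comm]
  rw [this]
  simp_rw [fsum_axis_bond]

section Gram

open ComplexConjugate
open scoped InnerProductSpace

variable {E : Type*} [NormedAddCommGroup E] [InnerProductSpace ℂ E]

/-- Gram function of a family of vectors `w_B` (positive occupation form). -/
def gram (wv : (Fin 3 → ZMod K) → E) : (Fin 3 → ZMod K) → (Fin 3 → ZMod K) → ℂ :=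
  fun B B' => ⟪wv B, wv B'⟫_ℂ

omit [NeZero K] in
/-- The diagonal Gram entry `⟪w_B, w_B⟫` is `‖w_B‖²`. -/
theorem gram_self (wv : (Fin 3 → ZMod K) → E) (B : Fin 3 → ZMod K) :
    gram wv B B = ((‖wv B‖ ^ 2 : ℝ) : ℂ) := by
  unfold gram
  rw [inner_self_eq_norm_sq_to_K]
  push_cast
  rfl

omit [NeZero K] in
/-- In the Gram representation the bond occupation is `‖w_B − w_{B+e_j}‖²/2`. -/
theorem nA_gram (wv : (Fin 3 → ZMod K) → E) (B : Fin 3 → ZMod K) (j : Fin 3) :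
    nA (gram wv) B j = ((‖wv B - wv (B + e j)‖ ^ 2 / 2 : ℝ) : ℂ) := by
  unfold nA gram
  have hs : ∀ x : E, ⟪x, x⟫_ℂ = ((‖x‖ ^ 2 : ℝ) : ℂ) := fun x => by
    rw [inner_self_eq_norm_sq_to_K]; push_cast; rfl
  have h3 : ⟪wv (B + e j), wv B⟫_ℂ = conj ⟪wv B, wv (B + e j)⟫_ℂ := (inner_conj_symm _ _).symm
  have h4 : ‖wv B - wv (B + e j)‖ ^ 2
      = ‖wv B‖ ^ 2 - 2 * (⟪wv B, wv (B + e j)⟫_ℂ).re + ‖wv (B + e j)‖ ^ 2 := by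
    rw [norm_sub_sq (𝕜 := ℂ)]
    simp only [RCLike.re_to_complex]
  have h5 : ⟪wv B, wv (B + e j)⟫_ℂ + conj ⟪wv B, wv (B + e j)⟫_ℂ
      = ((2 * (⟪wv B, wv (B + e j)⟫_ℂ).re : ℝ) : ℂ) := Complex.add_conj _
  rw [hs (wv B), hs (wv (B + e j)), h3, h4,
    show ((‖wv B‖ ^ 2 : ℝ) : ℂ) + ((‖wv (B + e j)‖ ^ 2 : ℝ) : ℂ) - ⟪wv B, wv (B + e j)⟫_ℂ
        - conj ⟪wv B, wv (B + e j)⟫_ℂ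
      = ((‖wv B‖ ^ 2 : ℝ) : ℂ) + ((‖wv (B + e j)‖ ^ 2 : ℝ) : ℂ)
        - (⟪wv B, wv (B + e j)⟫_ℂ + conj ⟪wv B, wv (B + e j)⟫_ℂ) by ring,
    h5]
  push_cast
  ring

/-- Corner embedding of `τ ∈ {0,1}³` into the block torus. -/
def iota (τ : Fin 3 → Fin 2) : Fin 3 → ZMod K := fun i => ((τ i : ℕ) : ZMod K)

omit [NeZero K] in
/-- Updating one coordinate of a corner index vector by `1` lands on the translated corner. -/
theorem iota_update_one (τ : Fin 3 → Fin 2) (j : Fin 3) (hτ : τ j = 0) :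
    iota (K := K) (Function.update τ j 1) = iota τ + e j := by
  funext i
  unfold iota e
  by_cases h : i = j
  · subst h
    simp [hτ]
  · simp [Function.update_of_ne h, Pi.single_eq_of_ne h]

omit [NeZero K] in
/-- Splitting the 8 blocks of a super-block into the 4 j-bonds: `Σ_τ f(c+τ) = Σ_{τ_j=0} (f(c+τ) + f(c+τ+e_j))`. -/
theorem sum_cube_split {M : Type*} [AddCommMonoid M] (f : (Fin 3 → ZMod K) → M)
    (c : Fin 3 → ZMod K) (j : Fin 3) :
    ∑ τ : Fin 3 → Fin 2, f (c + iota τ)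
      = ∑ τ ∈ Finset.univ.filter (fun τ : Fin 3 → Fin 2 => τ j = 0),
          (f (c + iota τ) + f (c + iota τ + e j)) := by
  classical
  rw [Finset.sum_add_distrib,
    ← Finset.sum_filter_add_sum_filter_not Finset.univ (fun τ : Fin 3 → Fin 2 => τ j = 0)]
  congr 1
  symm
  refine Finset.sum_nbij' (fun τ => Function.update τ j 1) (fun τ => Function.update τ j 0)
    ?_ ?_ ?_ ?_ ?_
  · intro τ hτ
    simp
  · intro τ hτ
    simp
  · intro τ hτ
    rw [Finset.mem_filter] at hτ
    funext i
    by_cases h : i = j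
    · subst h; simp [hτ.2]
    · simp [Function.update_of_ne h]
  · intro τ hτ
    rw [Finset.mem_filter] at hτ
    have h1 : τ j = 1 := Fin.eq_one_of_ne_zero _ hτ.2
    funext i
    by_cases h : i = j
    · subst h; simp [h1]
    · simp [Function.update_of_ne h]
  · intro τ hτ
    rw [Finset.mem_filter] at hτ
    rw [iota_update_one τ j hτ.2, add_assoc]

/-- `#{τ ∈ {0,1}³ : τ_j = 0} = 4`. -/
theorem card_filter_cube (j : Fin 3) :
    (Finset.univ.filter (fun τ : Fin 3 → Fin 2 => τ j = 0)).card = 4 := by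
  fin_cases j <;> decide

omit [NeZero K] in
/-- **Cauchy–Schwarz in one super-block, one axis:** the four interior j-bonds carry at most the
block occupations minus the super-block (normalised indicator) occupation. -/
theorem superblock_cs (wv : (Fin 3 → ZMod K) → E) (c : Fin 3 → ZMod K) (j : Fin 3) :
    ∑ τ ∈ Finset.univ.filter (fun τ : Fin 3 → Fin 2 => τ j = 0),
        ‖wv (c + iota τ) - wv (c + iota τ + e j)‖ ^ 2 / 2
      ≤ ∑ τ : Fin 3 → Fin 2, ‖wv (c + iota τ)‖ ^ 2
          - ‖∑ τ : Fin 3 → Fin 2, wv (c + iota τ)‖ ^ 2 / 8 := by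
  classical
  set T := Finset.univ.filter (fun τ : Fin 3 → Fin 2 => τ j = 0) with hT
  -- parallelogram law, bond by bond
  have hpar : ∀ τ : Fin 3 → Fin 2, ‖wv (c + iota τ) - wv (c + iota τ + e j)‖ ^ 2 / 2
      = (‖wv (c + iota τ)‖ ^ 2 + ‖wv (c + iota τ + e j)‖ ^ 2)
          - ‖wv (c + iota τ) + wv (c + iota τ + e j)‖ ^ 2 / 2 := by
    intro τ
    have := parallelogram_law_with_norm ℂ (wv (c + iota τ)) (wv (c + iota τ + e j))
    linarith
  simp_rw [hpar]
  rw [Finset.sum_sub_distrib, ← sum_cube_split (fun B => ‖wv B‖ ^ 2) c j]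
  -- the super-block vector is the sum of the 4 symmetric pair vectors
  have hsum : ∑ τ : Fin 3 → Fin 2, wv (c + iota τ)
      = ∑ τ ∈ T, (wv (c + iota τ) + wv (c + iota τ + e j)) := sum_cube_split wv c j
  have hcard : T.card ≤ 4 := (card_filter_cube (j := j)).le
  -- Cauchy–Schwarz: ‖Σ_{τ∈T} v_τ‖² ≤ |T| Σ ‖v_τ‖² ≤ 4 Σ ‖v_τ‖²
  have hcs : ‖∑ τ : Fin 3 → Fin 2, wv (c + iota τ)‖ ^ 2
      ≤ 4 * ∑ τ ∈ T, ‖wv (c + iota τ) + wv (c + iota τ + e j)‖ ^ 2 := by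
    rw [hsum]
    calc ‖∑ τ ∈ T, (wv (c + iota τ) + wv (c + iota τ + e j))‖ ^ 2
        ≤ (∑ τ ∈ T, ‖wv (c + iota τ) + wv (c + iota τ + e j)‖) ^ 2 := by
          gcongr
          exact norm_sum_le _ _
      _ ≤ T.card * ∑ τ ∈ T, ‖wv (c + iota τ) + wv (c + iota τ + e j)‖ ^ 2 :=
          sq_sum_le_card_mul_sum_sq
      _ ≤ 4 * ∑ τ ∈ T, ‖wv (c + iota τ) + wv (c + iota τ + e j)‖ ^ 2 :=
          mul_le_mul_of_nonneg_right (by exact_mod_cast hcard)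
            (Finset.sum_nonneg fun _ _ => sq_nonneg _)
  have : ‖∑ τ : Fin 3 → Fin 2, wv (c + iota τ)‖ ^ 2 / 8
      ≤ ∑ τ ∈ T, ‖wv (c + iota τ) + wv (c + iota τ + e j)‖ ^ 2 / 2 := by
    rw [← Finset.sum_div]
    linarith
  linarith

/-- Translation count: every block is the `τ`-corner of exactly one super-block per `τ`, so summing a
block function over all corners and a set `T` of offsets counts it `|T|` times. -/
theorem sum_corners (f : (Fin 3 → ZMod K) → ℝ) (T : Finset (Fin 3 → Fin 2)) :
    ∑ c : Fin 3 → ZMod K, ∑ τ ∈ T, f (c + iota τ) = T.card * ∑ B : Fin 3 → ZMod K, f B := by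
  classical
  rw [Finset.sum_comm]
  have : ∀ τ ∈ T, ∑ c : Fin 3 → ZMod K, f (c + iota τ) = ∑ B : Fin 3 → ZMod K, f B := by
    intro τ _
    exact Fintype.sum_equiv (Equiv.addRight (iota τ)) _ _ fun c => rfl
  rw [Finset.sum_congr rfl this, Finset.sum_const, nsmul_eq_mul]

/-- **Shell budget, super-block form (abstract, real).** Block occupations dominated by particle
numbers (`‖w_B‖² ≤ N_B`, `Σ N_B = N`) and super-block condensation summed over ALL `K³` corners
(= the 8 half-shifted tilings together) `Σ_c ‖Σ_τ w_{c+τ}‖²/8 ≥ 8(1−η)N` give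
`Σ_j Σ_B ‖w_B − w_{B+e_j}‖²/2 ≤ 6ηN`. -/
theorem shellBudget_superblock (wv : (Fin 3 → ZMod K) → E) (Nb : (Fin 3 → ZMod K) → ℝ) (N η : ℝ)
    (hdiag : ∀ B, ‖wv B‖ ^ 2 ≤ Nb B) (hN : ∑ B, Nb B = N)
    (hfam : 8 * ((1 - η) * N)
      ≤ ∑ c : Fin 3 → ZMod K, ‖∑ τ : Fin 3 → Fin 2, wv (c + iota τ)‖ ^ 2 / 8) :
    ∑ j : Fin 3, ∑ B : Fin 3 → ZMod K, ‖wv B - wv (B + e j)‖ ^ 2 / 2 ≤ 6 * η * N := by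
  classical
  have h1 : ∑ B : Fin 3 → ZMod K, ‖wv B‖ ^ 2 ≤ N := hN ▸ Finset.sum_le_sum fun B _ => hdiag B
  have haxis : ∀ j : Fin 3, ∑ B : Fin 3 → ZMod K, ‖wv B - wv (B + e j)‖ ^ 2 / 2 ≤ 2 * η * N := by
    intro j
    set T := Finset.univ.filter (fun τ : Fin 3 → Fin 2 => τ j = 0) with hT
    have hcard : (T.card : ℝ) = 4 := by exact_mod_cast card_filter_cube (j := j)
    -- 4 · Σ_B bond = Σ_c Σ_{τ∈T} bond(c+τ)
    have hcount := sum_corners (K := K) (fun B => ‖wv B - wv (B + e j)‖ ^ 2 / 2) T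
    rw [hcard] at hcount
    -- per corner: Cauchy–Schwarz
    have hper : ∑ c : Fin 3 → ZMod K, ∑ τ ∈ T, ‖wv (c + iota τ) - wv (c + iota τ + e j)‖ ^ 2 / 2
        ≤ ∑ c : Fin 3 → ZMod K, (∑ τ : Fin 3 → Fin 2, ‖wv (c + iota τ)‖ ^ 2
            - ‖∑ τ : Fin 3 → Fin 2, wv (c + iota τ)‖ ^ 2 / 8) :=
      Finset.sum_le_sum fun c _ => superblock_cs wv c j
    rw [hcount, Finset.sum_sub_distrib] at hper
    -- Σ_c Σ_τ ‖w_{c+τ}‖² = 8 Σ_B ‖w_B‖²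
    have h8 := sum_corners (K := K) (fun B => ‖wv B‖ ^ 2) (Finset.univ : Finset (Fin 3 → Fin 2))
    have hc8 : ((Finset.univ : Finset (Fin 3 → Fin 2)).card : ℝ) = 8 := by
      rw [Finset.card_univ, Fintype.card_fun, Fintype.card_fin, Fintype.card_fin]; norm_num
    rw [hc8] at h8
    rw [h8] at hper
    nlinarith [hper, h1, hfam]
  calc ∑ j : Fin 3, ∑ B : Fin 3 → ZMod K, ‖wv B - wv (B + e j)‖ ^ 2 / 2
      ≤ ∑ _j : Fin 3, 2 * η * N := Finset.sum_le_sum fun j _ => haxis j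
    _ = 6 * η * N := by
        rw [Finset.sum_const, Finset.card_univ, Fintype.card_fin, nsmul_eq_mul]
        push_cast; ring

/-- **Shell budget in the Gram representation:** the `ε`-weighted block-wave occupation (a real number,
the real part of `Σ_q ε(q) nf q`) is at most `6ηN`. -/
theorem shellBudget_gram (wv : (Fin 3 → ZMod K) → E) (Nb : (Fin 3 → ZMod K) → ℝ) (N η : ℝ)
    (hdiag : ∀ B, ‖wv B‖ ^ 2 ≤ Nb B) (hN : ∑ B, Nb B = N)
    (hfam : 8 * ((1 - η) * N)
      ≤ ∑ c : Fin 3 → ZMod K, ‖∑ τ : Fin 3 → Fin 2, wv (c + iota τ)‖ ^ 2 / 8) :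
    (∑ q : Fin 3 → ZMod K, eps q * nf (gram wv) q).re ≤ 6 * η * N := by
  classical
  rw [fsum_total_bond]
  have hsum : (∑ j : Fin 3, ∑ B : Fin 3 → ZMod K, nA (gram wv) B j)
      = ((∑ j : Fin 3, ∑ B : Fin 3 → ZMod K, ‖wv B - wv (B + e j)‖ ^ 2 / 2 : ℝ) : ℂ) := by
    push_cast
    refine Finset.sum_congr rfl fun j _ => Finset.sum_congr rfl fun B _ => ?_
    rw [nA_gram]
    push_cast
    ring
  rw [hsum, Complex.ofReal_re]
  exact shellBudget_superblock wv Nb N η hdiag hN hfam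

end Gram

end

end Summit.AtomisticToContinuum.BoseEinsteinCondensation.Theses.BlockLatticeFSum.Engine
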